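import Literature.Computability.FineGrained.CliqueETHReductionProgram
import HarnessLib

/-!
# Williams' split-and-list reduction: the Orthogonal Vectors instance of a CNF

The machine-free core of R. Williams' reduction from CNF-SAT to Orthogonal Vectors
(*A new algorithm for optimal 2-constraint satisfaction and its implications*, Theoret. Comput.
Sci. 348 (2005) 357–365, §5.1, Theorem 5 of the author's version = Thm. 5.1: "If the cooperative
subset query problem with `d = |U|` and `k = max{|D₁|, |D₂|}` is solvable in `Õ(f(d) k^{2-ε})`
time, then CNF-SAT is in `Õ(f(m) 2^{(1-ε/2)n})` time, where `m` is the number of clauses and `n`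
is the number of variables"; proof: "Arbitrarily partition the `n` variables into two sets
`P₁, P₂` of size `n/2` each, and build respective lists `L₁, L₂` of `2^{n/2}` assignments for the
`Pᵢ`. … Associate with each `p ∈ L₁` a set `S_p`, defined by the condition `c_j ∈ S_p` if and only
if `p` does not satisfy `c_j`. For `p' ∈ L₂`, make a set `S_{p'}`, defined by `c_j ∈ S_{p'}` if
and only if `p'` satisfies `c_j`. … the collection of clauses is satisfiable if and only if this
cooperative subset query instance has a 'yes' answer"), in the Orthogonal-Vectors form used by
the fine-grained literature (Bringmann–Künnemann, FOCS 2015, Lemma 2.1; Backurs–Indyk, STOC 2015,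
§2; V. Vassilevska Williams, ICM 2018, proof of Thm. 3.1): `u_p[j] = 1` iff the partial
assignment `p` of the first half does **not** satisfy clause `j`, `v_q[j] = 1` iff the partial
assignment `q` of the second half does not satisfy clause `j`, so that `⟨u_p, v_q⟩ = 0` iff the
total assignment `(p, q)` satisfies every clause.

This file is the first of three proving the named fact
`Literature.Computability.FineGrained.kSATInRAMTime_of_ovInTimePolyDim` (`EditDistanceSETH.lean`):

* `SplitList.half n = ⌈n/2⌉`, the size of the first half of the variables `x₀, …, x_{n-1}`
  (the first half is `x₀ … x_{h-1}`, the second half `x_h … x_{n-1}`, of size `n - h ≤ h`);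
* `SplitList.satW φ h side w j`: clause `j` of `φ` contains a literal on a variable of the given
  side (`side = true`: variable `< h`; `side = false`: variable `≥ h`) made true by the assignment
  word `w` (bit `v` of `w` is the value of `x_v`; for the second half the word is `q · 2^h`, so
  that bit `v` of it is bit `v - h` of `q`) — the form computed by the word-RAM program of
  `SplitAndListProgram.lean`;
* `SplitList.splitOV φ : OVInstance`, `N = 2^h` vectors per side of dimension `m = |φ|`,
  `A p j = ¬ satW φ h true p j`, `B q j = ¬ satW φ h false (q 2^h) j`;
* **`SplitList.hasOrthogonalPair_splitOV_iff`**: `splitOV φ` has an orthogonal pair iff `φ` is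
  satisfiable (Williams' "It is easy to see");
* the word encoding of `splitOV φ` as an `OV` input (`OV.encode`): length `2 + 2 N m`, the header
  `N, m`, the bit at position `2 + (p m + j)` resp. `2 + N m + (q m + j)`, its input width
  `Nat.size (max (2 + 2 N m) N)`, and the accepted output `[1]`/`[0]`.

## References

* R. Williams, *A new algorithm for optimal 2-constraint satisfaction and its implications*,
  Theoret. Comput. Sci. 348 (2005) 357–365, §5.1, Thm. 5.1 (Theorem 5 of the author's version).
* K. Bringmann, M. Künnemann, *Quadratic conditional lower bounds for string problems and
  dynamic time warping*, FOCS 2015, Lemma 2.1.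
* V. Vassilevska Williams, *On some fine-grained questions in algorithms and complexity*,
  Proc. ICM 2018, §3, proof of Thm. 3.1.
-/

namespace Literature.Computability.FineGrained

open Cryptography Cryptography.WordRAM Complexity

namespace SplitList

/-! ### The halves of the variables -/

/-- The size `h = ⌈n/2⌉` of the first half `x₀, …, x_{h-1}` of the variables (Williams: "assume
`n` is divisible by 2 … two sets `P₁, P₂` of size `n/2` each"; for odd `n` the second half has
`n - h = ⌊n/2⌋` variables). [cite: WilliamsTCS2005, §5.1 Thm. 5.1 (proof)] -/
def half (n : ℕ) : ℕ := (n + 1) / 2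

/-- Both halves have at most `h` variables: `n ≤ 2h`. [folklore] -/
theorem le_two_mul_half (n : ℕ) : n ≤ 2 * half n := by unfold half; omega

/-- `h ≤ n`. [folklore] -/
theorem half_le (n : ℕ) : half n ≤ n := by unfold half; omega

/-! ### Satisfaction of a clause by a half assignment -/

/-- `satW φ h side w j`: clause `j` of `φ` (the empty clause past the end) has a literal `(v, b)`
on a variable of the given side — `side = true`: `v < h` (first half), `side = false`: `h ≤ v`
(second half) — whose value under the assignment word `w` (variable `x_v` ↦ bit `v` of `w`) is
true, i.e. `w.testBit v = b`. For the first half `w = p < 2^h` is the partial assignment itself;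
for the second half `w = q · 2^h`, whose bit `v ≥ h` is bit `v - h` of the partial assignment
`q` of `x_h, …, x_{n-1}`. (Williams: "`p` satisfies `c_j`".)
[cite: WilliamsTCS2005, §5.1 Thm. 5.1 (proof)] -/
def satW (φ : CNF ℕ) (h : ℕ) (side : Bool) (w j : ℕ) : Bool :=
  (φ.getD j []).any fun l => (decide (l.1 < h) == side) && (w.testBit l.1 == l.2)

/-- Unfolding `satW`. [folklore] -/
theorem satW_eq_true_iff (φ : CNF ℕ) (h : ℕ) (side : Bool) (w j : ℕ) :
    satW φ h side w j = true ↔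
      ∃ l ∈ φ.getD j [], decide (l.1 < h) = side ∧ w.testBit l.1 = l.2 := by
  simp [satW, List.any_eq_true]

/-- Past the last clause nothing is satisfied. [folklore] -/
theorem satW_of_le {φ : CNF ℕ} {j : ℕ} (hj : φ.length ≤ j) (h : ℕ) (side : Bool) (w : ℕ) :
    satW φ h side w j = false := by
  unfold satW; rw [List.getD_eq_default _ _ hj]; rfl

/-! ### The OV instance -/

/-- **The split-and-list OV instance of a CNF** (Williams 2005, proof of Thm. 5.1, in OV form):
`N = 2^h` vectors per side (`h = ⌈n/2⌉`, `n = numVars φ`), dimension `m = |φ|`; vector `u_p` of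
the first list has `u_p[j] = 1` iff the partial assignment `p` of `x₀ … x_{h-1}` does not already
satisfy clause `j`, vector `v_q` of the second list has `v_q[j] = 1` iff the partial assignment
`q` of `x_h … x_{n-1}` does not already satisfy clause `j` (Williams' sets `S_p = {j : p ⊭ c_j}`
and the complement of `S_{p'} = {j : p' ⊨ c_j}`: `S_p ⊆ S_{p'}` iff `⟨u_p, v_{p'}⟩ = 0`).
[cite: WilliamsTCS2005, §5.1 Thm. 5.1 (proof)] -/
def splitOV (φ : CNF ℕ) : OVInstance where
  n := 2 ^ half φ.numVars
  d := φ.length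
  A := fun p j => !satW φ (half φ.numVars) true p j
  B := fun q j => !satW φ (half φ.numVars) false (q * 2 ^ half φ.numVars) j

/-- The number of vectors per side is `N = 2^h`. [folklore] -/
@[simp] theorem splitOV_n (φ : CNF ℕ) : (splitOV φ).n = 2 ^ half φ.numVars := rfl

/-- The dimension is the number of clauses. [folklore] -/
@[simp] theorem splitOV_d (φ : CNF ℕ) : (splitOV φ).d = φ.length := rfl

/-- **Williams' split-and-list correspondence.** The OV instance `splitOV φ` has an orthogonal
pair iff `φ` is satisfiable: `⟨u_p, v_q⟩ = 0` iff every clause is satisfied by `p` (on the first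
half) or by `q` (on the second half) iff the total assignment `(p, q)` satisfies `φ`; conversely a
satisfying assignment restricts to the two halves. (Williams, TCS 2005, proof of Thm. 5.1: "the
collection of clauses `{c₁, …, c_m}` is satisfiable if and only if this cooperative subset query
instance has a 'yes' answer".) [cite: WilliamsTCS2005, §5.1 Thm. 5.1 (proof)] -/
theorem hasOrthogonalPair_splitOV_iff (φ : CNF ℕ) :
    (splitOV φ).HasOrthogonalPair ↔ φ.Satisfiable := by
  constructor
  · rintro ⟨p, q, hpq⟩
    refine ⟨fun v => if v < half φ.numVars then (p : ℕ).testBit v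
      else (q : ℕ).testBit (v - half φ.numVars), ?_⟩
    rw [CNF.eval_eq_true_iff]
    intro c hc
    obtain ⟨j, hj, rfl⟩ := List.getElem_of_mem hc
    have hj' : j < (splitOV φ).d := hj
    have key := hpq ⟨j, hj'⟩
    simp only [splitOV, Bool.not_eq_true', not_and, Bool.eq_false_iff, ne_eq, not_not] at key
    -- `key : satW … true p j = false → satW … false (q 2^h) j = true`
    have hgetD : φ.getD j [] = φ[j] := List.getD_eq_getElem _ _ hj
    unfold Clause.eval
    rw [List.any_eq_true]
    by_cases hA : satW φ (half φ.numVars) true p j = true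
    · obtain ⟨l, hl, hside, hbit⟩ := (satW_eq_true_iff _ _ _ _ _).1 hA
      rw [hgetD] at hl
      have hv : l.1 < half φ.numVars := of_decide_eq_true hside
      refine ⟨l, hl, ?_⟩
      show ((if l.1 < half φ.numVars then (p : ℕ).testBit l.1
        else (q : ℕ).testBit (l.1 - half φ.numVars)) == l.2) = true
      rw [if_pos hv, hbit]; exact beq_self_eq_true _
    · have hB := key hA
      obtain ⟨l, hl, hside, hbit⟩ := (satW_eq_true_iff _ _ _ _ _).1 hB
      rw [hgetD] at hl
      have hv : ¬ l.1 < half φ.numVars := of_decide_eq_false hside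
      rw [Nat.testBit_mul_two_pow] at hbit
      have hle : half φ.numVars ≤ l.1 := not_lt.1 hv
      simp only [hle, decide_true, Bool.true_and] at hbit
      refine ⟨l, hl, ?_⟩
      show ((if l.1 < half φ.numVars then (p : ℕ).testBit l.1
        else (q : ℕ).testBit (l.1 - half φ.numVars)) == l.2) = true
      rw [if_neg hv, hbit]; exact beq_self_eq_true _
  · rintro ⟨σ, hσ⟩
    rw [CNF.eval_eq_true_iff] at hσ
    have hpN : (Nat.ofBits fun i : Fin (half φ.numVars) => σ i) < 2 ^ half φ.numVars :=
      Nat.ofBits_lt_two_pow _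
    have hqN : (Nat.ofBits fun i : Fin (half φ.numVars) => σ (half φ.numVars + i)) <
        2 ^ half φ.numVars := Nat.ofBits_lt_two_pow _
    refine ⟨⟨_, hpN⟩, ⟨_, hqN⟩, fun j => ?_⟩
    have hj : (j : ℕ) < φ.length := j.2
    simp only [splitOV, Bool.not_eq_true', not_and, Bool.eq_false_iff, ne_eq, not_not]
    intro hA
    have hgetD : φ.getD j [] = φ[(j : ℕ)] := List.getD_eq_getElem _ _ hj
    have hc := hσ _ (List.getElem_mem hj)
    unfold Clause.eval at hc
    obtain ⟨l, hl, hev⟩ := List.any_eq_true.1 hc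
    have hval : σ l.1 = l.2 := by simpa [Literal.eval] using hev
    have hvar : l.1 < φ.numVars := CliqueRed.lt_numVars_of_mem (List.getElem_mem hj) hl
    have h2 : l.1 < 2 * half φ.numVars := lt_of_lt_of_le hvar (le_two_mul_half _)
    by_cases hv : l.1 < half φ.numVars
    · -- the literal is on the first half: `p` satisfies the clause, contradicting `hA`
      refine absurd ?_ hA
      rw [satW_eq_true_iff]
      refine ⟨l, hgetD ▸ hl, decide_eq_true hv, ?_⟩
      rw [Nat.testBit_ofBits_lt _ _ hv]; exact hval
    · rw [satW_eq_true_iff]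
      refine ⟨l, hgetD ▸ hl, decide_eq_false hv, ?_⟩
      have hle : half φ.numVars ≤ l.1 := not_lt.1 hv
      rw [Nat.testBit_mul_two_pow]
      simp only [hle, decide_true, Bool.true_and]
      rw [Nat.testBit_ofBits_lt _ _ (by omega)]
      simp only
      rw [show half φ.numVars + (l.1 - half φ.numVars) = l.1 by omega]
      exact hval

end SplitList

/-! ### The `OV` encoding of an instance -/

/-- An encoded Boolean vector has one word per coordinate. [folklore] -/
theorem length_encodeBoolVec {d : ℕ} (v : Fin d → Bool) : (encodeBoolVec v).length = d := by
  simp [encodeBoolVec]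

/-- The words of an encoded Boolean vector are its bits. [folklore] -/
theorem encodeBoolVec_getElem? {d : ℕ} (v : Fin d → Bool) (t : Fin d) :
    (encodeBoolVec v)[(t : ℕ)]? = some (v t).toNat := by
  simp [encodeBoolVec]

/-- The words of an encoded Boolean vector are bits. [folklore] -/
theorem le_one_of_mem_encodeBoolVec {d : ℕ} (v : Fin d → Bool) {a : ℕ} (ha : a ∈ encodeBoolVec v) :
    a ≤ 1 := by
  simp only [encodeBoolVec, List.mem_map] at ha
  obtain ⟨t, -, rfl⟩ := ha
  exact Bool.toNat_le _

/-- A list of `N` encoded vectors of dimension `d` has `N d` words. [folklore] -/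
theorem length_flatMap_encodeBoolVec {N d : ℕ} (F : Fin N → Fin d → Bool) :
    ((List.finRange N).flatMap fun i => encodeBoolVec (F i)).length = N * d := by
  simp [List.length_flatMap, length_encodeBoolVec]

/-- The `OV` input of an instance: `n :: d ::` the rows of `A`, then the rows of `B`. [folklore] -/
theorem OV_encode_eq (I : OVInstance) :
    OV.encode I = I.n :: I.d :: (((List.finRange I.n).flatMap fun i => encodeBoolVec (I.A i)) ++
      ((List.finRange I.n).flatMap fun i => encodeBoolVec (I.B i))) := rfl

/-- **The length of an `OV` input**: `2 + 2 n d`. [folklore] -/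
theorem length_OV_encode (I : OVInstance) : (OV.encode I).length = 2 + 2 * (I.n * I.d) := by
  rw [OV_encode_eq, List.length_cons, List.length_cons, List.length_append, length_flatMap_encodeBoolVec,
    length_flatMap_encodeBoolVec]
  ring

/-- Word `0` of an `OV` input is `n`. [folklore] -/
theorem OV_encode_getElem?_zero (I : OVInstance) : (OV.encode I)[0]? = some I.n := rfl

/-- Word `1` of an `OV` input is `d`. [folklore] -/
theorem OV_encode_getElem?_one (I : OVInstance) : (OV.encode I)[1]? = some I.d := rfl

/-- Word `2 + (p d + j)` of an `OV` input is the bit `A p j`. [folklore] -/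
theorem OV_encode_getElem?_A (I : OVInstance) (p : Fin I.n) (j : Fin I.d) :
    (OV.encode I)[2 + ((p : ℕ) * I.d + j)]? = some (I.A p j).toNat := by
  have hlt : (p : ℕ) * I.d + j < I.n * I.d :=
    calc (p : ℕ) * I.d + j < p * I.d + I.d := by omega
      _ = (p + 1) * I.d := by ring
      _ ≤ I.n * I.d := Nat.mul_le_mul_right _ p.2
  rw [OV_encode_eq, show 2 + ((p : ℕ) * I.d + j) = ((p : ℕ) * I.d + j) + 1 + 1 by ring,
    List.getElem?_cons_succ, List.getElem?_cons_succ,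
    List.getElem?_append_left (by rw [length_flatMap_encodeBoolVec]; exact hlt),
    getElem?_flatMap_const _ (List.finRange _) (fun i _ => length_encodeBoolVec _) p (by simp)
      j j.2]
  simp only [List.getElem_finRange]
  exact encodeBoolVec_getElem? _ j

/-- Word `2 + n d + (q d + j)` of an `OV` input is the bit `B q j`. [folklore] -/
theorem OV_encode_getElem?_B (I : OVInstance) (q : Fin I.n) (j : Fin I.d) :
    (OV.encode I)[2 + (I.n * I.d + ((q : ℕ) * I.d + j))]? = some (I.B q j).toNat := by
  rw [OV_encode_eq, show 2 + (I.n * I.d + ((q : ℕ) * I.d + j)) = (I.n * I.d + ((q : ℕ) * I.d + j)) + 1 + 1 by ring,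
    List.getElem?_cons_succ, List.getElem?_cons_succ,
    List.getElem?_append_right (by rw [length_flatMap_encodeBoolVec]; omega),
    length_flatMap_encodeBoolVec, Nat.add_sub_cancel_left,
    getElem?_flatMap_const _ (List.finRange _) (fun i _ => length_encodeBoolVec _) q (by simp)
      j j.2]
  simp only [List.getElem_finRange]
  exact encodeBoolVec_getElem? _ j

/-- Every word of an `OV` input is `n`, `d` or a bit. [folklore] -/
theorem le_of_mem_OV_encode (I : OVInstance) {a : ℕ} (ha : a ∈ OV.encode I) :
    a ≤ max I.n (max I.d 1) := by
  rw [OV_encode_eq] at ha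
  simp only [List.mem_cons, List.mem_append, List.mem_flatMap] at ha
  rcases ha with rfl | rfl | ⟨i, -, hi⟩ | ⟨i, -, hi⟩
  · exact le_max_left _ _
  · exact le_max_of_le_right (le_max_left _ _)
  · exact le_max_of_le_right (le_max_of_le_right (le_one_of_mem_encodeBoolVec _ hi))
  · exact le_max_of_le_right (le_max_of_le_right (le_one_of_mem_encodeBoolVec _ hi))

/-- `n` is a word of an `OV` input, so the maximum word is at least `n`. [folklore] -/
theorem n_le_foldr_OV_encode (I : OVInstance) : I.n ≤ (OV.encode I).foldr max 1 := by
  rw [OV_encode_eq, List.foldr_cons]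
  exact le_max_left _ _

/-- **The input width of an `OV` input with `n ≥ 1`** is `Nat.size (max (2 + 2 n d) n)`: the
length dominates `d` and the bits, and `n` dominates the length only when `d = 0`. [folklore] -/
theorem inputWidth_OV_encode {I : OVInstance} (hn : 1 ≤ I.n) :
    inputWidth (OV.encode I) = Nat.size (max (2 + 2 * (I.n * I.d)) I.n) := by
  unfold inputWidth
  rw [length_OV_encode]
  congr 1
  apply le_antisymm
  · refine max_le (le_max_left _ _) (foldr_max_one_le (le_max_of_le_left (by omega)) ?_)
    intro v hv
    refine (le_of_mem_OV_encode I hv).trans (max_le (le_max_right _ _) ?_)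
    refine max_le ?_ (le_max_of_le_left (by omega))
    have : I.d ≤ I.n * I.d := Nat.le_mul_of_pos_left _ hn
    exact le_max_of_le_left (by omega)
  · exact max_le (le_max_left _ _) (le_max_of_le_right (n_le_foldr_OV_encode I))

/-! ### The encoding of the split-and-list instance -/

namespace SplitList

/-- `1 ≤ N`. [folklore] -/
theorem one_le_splitOV_n (φ : CNF ℕ) : 1 ≤ (splitOV φ).n := Nat.one_le_two_pow

/-- The width of `splitOV φ` as an `OV` instance: `Nat.size (max (2 + 2 N m) N)`. [folklore] -/
theorem OV_width_splitOV (φ : CNF ℕ) :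
    OV.width (splitOV φ) = Nat.size (max (2 + 2 * ((splitOV φ).n * φ.length)) (splitOV φ).n) :=
  inputWidth_OV_encode (one_le_splitOV_n φ)

/-- The size of `splitOV φ` as an `OV` instance is `N`. [folklore] -/
theorem OV_size_splitOV (φ : CNF ℕ) : OV.size (splitOV φ) = (splitOV φ).n := rfl

open scoped Classical in
/-- **The accepted output on the instance**: `[1]` if `φ` is satisfiable, `[0]` otherwise.
[folklore] -/
theorem OV_good_splitOV (φ : CNF ℕ) :
    OV.Good (splitOV φ) = {[if φ.Satisfiable then 1 else 0]} := by
  by_cases h : φ.Satisfiable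
  · rw [if_pos h]
    exact FGProblem.ofPred_good_of_pos _ _ _ _ ((hasOrthogonalPair_splitOV_iff φ).2 h)
  · rw [if_neg h]
    exact FGProblem.ofPred_good_of_neg _ _ _ _ (mt (hasOrthogonalPair_splitOV_iff φ).1 h)

end SplitList

end Literature.Computability.FineGrained
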